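import Literature.NumberTheory.EllipticCurves.HuShuYin2019.SylvesterNineQuotientParametrization
import HarnessLib

/-!
# Hu–Shu–Yin 2019, Prop. 2.1 (1) with §4.1 AS PRINTED: «the quotient map `X₀(3⁵) → X_Γ = E₉` is a modular
# parametrisation of degree `6`», invariant under `⟨W, A⟩` — the existential named fact (G3′)

Topic `NumberTheory/EllipticCurves/HuShuYin2019`; namespace `Literature.NumberTheory.EllipticCurves.HuShuYin2019`.
ONE NAMED FACT (`exists_deg_eq_six_isS3Invariant`, print, `def … : Prop`) and its rigidity-free trivial readings;
no instance, no notation, no `sorry`.  Sequel to `SylvesterNineQuotientParametrization.lean` (the printed matrices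
`W`, `A`, the predicate `IsS3Invariant Dt`, and the tree's earlier `∀`-form (G3) `phi_s3Invariant_of_deg_eq_six`,
whose docstring flags the «unprinted pinning» that EVERY degree-`6` datum is `±` HSY's quotient map).  Seat
`bsd-cm-k-ty1` (twentieth seating) on the cell planner's rulings D847/D849/D852/D853 (2026-08-30, «(G3-MIN)»: give
the one admitted print binder of crux `stmt-BirchSwinnertonDyer-19804` its print-exact NAME; this file is
NAME-ONLY by ruling D852).  Nothing here is specific to Selmer groups; no summit statement is proved or advanced
by this file alone; BSD is claimed for no curve.

## THE PRINT (Hu–Shu–Yin, Trans. AMS 372 (2019) = arXiv:1708.05266; pages/lines of the held text, re-read)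

* §2.1 p. 5 L29: «the quotient group `N/ℚ^×Γ₀(3⁵) ≃ S₃ ⋊ ℤ/3ℤ`, where `S₃` … is generated by the Atkin–Lehner
  operator `W = (0 1; −3⁵ 0)` and the matrix `A = (28 1/3; 3⁴ 1)`»; `Γ = ⟨Γ₀(3⁵), W, A⟩`, `X_Γ` its modular curve,
  identified «with an elliptic curve over `ℚ` with `[∞]` as its zero element».
* **Prop. 2.1 (1)** p. 5 L59–L61: «The elliptic curve `(X_Γ, [∞])` is isomorphic to `E₉` over `ℚ`.»  Proof, L76:
  «It is known from [DV17] that `E₉` is the natural quotient of `X₀(3⁵)` by the finite group `S₃`.»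
* **§4.1** p. 10 L59: «The elliptic curve `E₉` has conductor `3⁵`. Let `f : X₀(3⁵) → E₉` be a nontrivial modular
  parametrization which sends the infinity cusp `[∞]` to the zero element `O`. Explicitly, we may take `f` to be
  the quotient map `X₀(3⁵) → X_Γ = E₉` as in Proposition 2.1»; p. 11 L23:
  «`(f,f)_{R′} = (Vol(X_{R′×})/Vol(X_{R×})) deg f = 6 · Vol(R×)/Vol(R′×) = 4`» (**`deg f = 6`**).
* `E₉ : y² = x³ − 2⁴·3` (p. 5 L57) is `ℚ`-isomorphic to the tree's minimal model `⟨0, 0, 1, 0, −1⟩`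
  (`y² + y = x³ − 1`, `(x, y) ↦ (4x, 8y + 4)`; `SylvesterNineMinimalModel.lean`).

## WHAT IS TYPED, AND HOW IT RELATES TO PRINT AND TO (G3)

The tree speaks of HSY's `f` through «a `Dt : ModularParametrizationData ⟨0,0,1,0,−1⟩ 243`» (the newform of
`E₉` at level `3⁵ =` conductor, the Néron lattice and uniformisation of the minimal model, an integral
Manin-constant field `c` with `c Λ_f ⊆ Λ_E`, and the modular degree `deg` as the cofinite orbit-fibre count of
`φ = u(c · 2πi ∫ f_{E₉})` on `Y₀(3⁵)`; the convention of `stub_printInputsTwo` conjunct (1) and of the height display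
#19 clause (2)).  The named fact (G3′) `exists_deg_eq_six_isS3Invariant` says, AS PRINTED: there IS such a datum of
degree `6` whose map is `⟨W, A⟩`-invariant (`IsS3Invariant`: `φ (w₂₄₃ • τ) = φ τ`, `φ (A • τ) = φ τ`) — HSY's quotient
map `X₀(3⁵) → X₀(3⁵)/S₃ = X_Γ ≅ E₉`, `[∞] ↦ O`, `deg = 6`, composed with `ℍ → X₀(3⁵)` and lifted through the
uniformisation (its pull-back of the Néron differential is `c · 2πi f_{E₉}(τ) dτ` with `c ∈ ℤ`: the optimal
quotient's constant is integral, Edixhoven 1991 Prop. 2, and a homomorphism between minimal models acts on Néron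
differentials by an integer).

RELATION TO (G3) (recorded, proved ELSEWHERE): (G3′) ⟹ `∃ Dt, Dt.deg = 6` (conjunct (1) of `stub_printInputsTwo`;
`exists_deg_eq_six_isS3Invariant.exists_deg_eq_six` below) and (G3) ∧ (1) ⟹ (G3′)
(`exists_deg_eq_six_isS3Invariant_of` below, = `phi_s3Invariant_of_deg_eq_six.exists_of_exists`) are trivial;
**(G3′) ⟹ (G3)** is the RIGIDITY of parametrisation data — two data of one model at one level with the same
degree have `φ′ = ±φ` (`deg · c′² = deg′ · c²`), and both fields of `IsS3Invariant` are equalities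
`φ (g • τ) = φ τ`, so invariance transports — which is PROVED on the Summits side
(`Summits/BirchSwinnertonDyer/BirchSwinnertonDyer/Theorems/SylvesterTwoHeegnerIndexParametrizationRigidity.lean`,
`SylvesterTwoParamRigidity.φ_eq_or_eq_neg_of_deg_eq`, proposal p756959, and its consumer
`…Theorems/SylvesterTwoHeegnerIndexUpperConeOfPrintExact.lean`, `phi_s3Invariant_of_deg_eq_six_of_exists`); a
Literature module cannot import Summits modules, so that implication is deliberately NOT restated here (cell
ruling D852).  Whether (G3′) replaces (G3) ∧ (1) on the books / in the crux-19804 skeleton is a planner /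
INPUTS-desk decision, not made by this file.

## CONTENTS

* THE NAMED FACT (G3′) `exists_deg_eq_six_isS3Invariant` and its rigidity-free readings:
  `.exists_deg_eq_six` (conjunct (1) verbatim), `.exists_isS3Invariant`, `exists_deg_eq_six_isS3Invariant_of`
  ((G3) ∧ (1) ⟹ (G3′)).

## References

* [HuShuYin2019] Y. Hu, J. Shu, H. Yin, *An explicit Gross–Zagier formula related to the Sylvester conjecture*,
  Trans. AMS 372 (2019) (arXiv:1708.05266): §2.1 (p. 5 L29), Prop. 2.1 (1) (p. 5 L59–L61, proof L76), §4.1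
  (p. 10 L59, p. 11 L23).
* [DasguptaVoight2018] S. Dasgupta, J. Voight, *Sylvester's problem and mock Heegner points*, Proc. AMS 146 (2018)
  (HSY's [DV17]: `E₉ = X₀(243)/S₃`).
* [EdixhovenManin1991] B. Edixhoven, *On the Manin constants of modular elliptic curves* (1991), §1, Prop. 2.
-/

noncomputable section

open UpperHalfPlane
open scoped MatrixGroups

namespace Literature.NumberTheory.EllipticCurves.HuShuYin2019

open Literature.NumberTheory.EllipticCurves.ModularForms
open Literature.NumberTheory.EllipticCurves.ModularForms.ModularParametrizationData

/-- ★ **Hu–Shu–Yin 2019, Prop. 2.1 (1) with §4.1, AS PRINTED: `E₉` has a modular parametrisation at level `3⁵`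
of degree `6` that is invariant under `W` and `A` — the quotient map `X₀(3⁵) → X₀(3⁵)/S₃ = X_Γ ≅ E₉`.**
PRINT: «The elliptic curve `(X_Γ, [∞])` is isomorphic to `E₉` over `ℚ`» for `Γ = ⟨Γ₀(3⁵), W, A⟩` (Prop. 2.1 (1),
p. 5 L59–L61; proof L76: «It is known from [DV17] that `E₉` is the natural quotient of `X₀(3⁵)` by the finite
group `S₃`», `S₃ = ⟨W, A⟩`, `W = (0 1; −3⁵ 0)`, `A = (28 1/3; 3⁴ 1)`, p. 5 L29); «Let `f : X₀(3⁵) → E₉` be a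
nontrivial modular parametrization which sends the infinity cusp `[∞]` to the zero element `O`. Explicitly, we
may take `f` to be the quotient map `X₀(3⁵) → X_Γ = E₉`» (§4.1, p. 10 L59); «`deg f = 6`» (p. 11 L23).  TYPED as
the existence of a `Dt : ModularParametrizationData ⟨0,0,1,0,−1⟩ 243` (HSY's `f` composed with `ℍ → X₀(3⁵)` and
lifted through the uniformisation of the minimal model `y² + y = x³ − 1 ≅_ℚ E₉`; integral constant `c` with
`c Λ_f ⊆ Λ_E` by Edixhoven 1991 Prop. 2 for the optimal quotient and the Néron mapping property; `deg` = the
cofinite orbit-fibre count `= deg f`) with `Dt.deg = 6` and `IsS3Invariant Dt` (`Dt.φ (w₂₄₃ • τ) = Dt.φ τ`,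
`Dt.φ (A • τ) = Dt.φ τ`; `w₂₄₃ = frickeGL 243` acts as HSY's `W`, `glCast_hsyW_smul`).  This is the print-exact
`∃∧`-form (G3′) of the tree's earlier `∀`-form (G3) `phi_s3Invariant_of_deg_eq_six`; (G3′) ⟹ (G3) is the
rigidity of parametrisation data, proved Summits-side (module docstring), not restated here.  STATUS: PUB
(Trans. AMS), relying on [DV17] (Proc. AMS) and, for the existence of the datum, on the modularity of `E₉` (CM,
level = conductor `3⁵`) with an integral Manin constant; a FACT, not our theorem.
[cite: HuShuYin2019, Prop. 2.1 (1) (p. 5 L59–L61, proof L76), §2.1 (p. 5 L29), §4.1 (p. 10 L59, p. 11 L23)]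
[cite: DasguptaVoight2018, §2 (E₉ = X₀(243)/S₃)] [cite: EdixhovenManin1991, §1 and Prop. 2] -/
def exists_deg_eq_six_isS3Invariant : Prop :=
  ∃ Dt : ModularParametrizationData (⟨0, 0, 1, 0, -1⟩ : WeierstrassCurve ℚ) 243, Dt.deg = 6 ∧ IsS3Invariant Dt

/-- (G3′) ⟹ conjunct (1) of `stub_printInputsTwo`, VERBATIM: a degree-`6` parametrisation datum of `E₉` at level
`3⁵` exists. [cite: HuShuYin2019, §4.1 (p. 10 L59, p. 11 L23)] -/
theorem exists_deg_eq_six_isS3Invariant.exists_deg_eq_six (h : exists_deg_eq_six_isS3Invariant) :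
    ∃ Dt : ModularParametrizationData (⟨0, 0, 1, 0, -1⟩ : WeierstrassCurve ℚ) 243, Dt.deg = 6 := by
  obtain ⟨Dt, hdeg, -⟩ := h
  exact ⟨Dt, hdeg⟩

/-- (G3′) ⟹ some parametrisation datum of `E₉` at level `3⁵` is `⟨W, A⟩`-invariant.
[cite: HuShuYin2019, Prop. 2.1 (1) (p. 5 L59–L61, L76)] -/
theorem exists_deg_eq_six_isS3Invariant.exists_isS3Invariant (h : exists_deg_eq_six_isS3Invariant) :
    ∃ Dt : ModularParametrizationData (⟨0, 0, 1, 0, -1⟩ : WeierstrassCurve ℚ) 243, IsS3Invariant Dt := by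
  obtain ⟨Dt, -, hS3⟩ := h
  exact ⟨Dt, hS3⟩

/-- The trivial converse (G3) ∧ (1) ⟹ (G3′) (`phi_s3Invariant_of_deg_eq_six.exists_of_exists`); the non-trivial
direction (G3′) ⟹ (G3) is the rigidity of parametrisation data, proved Summits-side (module docstring).
[cite: HuShuYin2019, Prop. 2.1 (1) with §4.1] -/
theorem exists_deg_eq_six_isS3Invariant_of (h : phi_s3Invariant_of_deg_eq_six)
    (hex : ∃ Dt : ModularParametrizationData (⟨0, 0, 1, 0, -1⟩ : WeierstrassCurve ℚ) 243, Dt.deg = 6) :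
    exists_deg_eq_six_isS3Invariant :=
  h.exists_of_exists hex

end Literature.NumberTheory.EllipticCurves.HuShuYin2019

end
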